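import Mathlib
import Literature.NumberTheory.LFunctions.Zhang2022.Section14U004Line
import Literature.NumberTheory.LFunctions.Zhang2022.Section14U006a
import Literature.NumberTheory.LFunctions.Zhang2022.Section14Regrouping
import Literature.NumberTheory.LFunctions.Zhang2022.Section14Eq143Assembly
import HarnessLib

/-!
# Zhang (2022) §14 u004 (p. 76, tex L3858): "integration term by term" for `Ĩ₂(ψ)` — `Z22:§14.u004`
# DISCHARGED (`Typed.Sec14.step14u004_holds`), hence `Z22:§14.u010` (`Typed.Sec14.step14u010_holds`)

Topic `Literature/NumberTheory/LFunctions/Zhang2022` (Landau–Siegel audit tree; verdict-neutral).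
Y. Zhang, *Discrete mean estimates and the Landau–Siegel zero*, arXiv:2211.02515v1 (2022)
[Zhang2022LandauSiegel] — **an unrefereed manuscript under adjudication; nothing here asserts or
denies its Theorems 1–2.** ZHANG-L discharge lane (WP14); THEOREM-ONLY (no definition, no named fact).

§14 p. 76 (tex L3858), proof of Proposition 14.1, the step `Z22:§14.u004`:

> We use (2.5) with `θ = ψχ` and then replace the segment `𝔍(1)` by the vertical line `σ = 3/2`
> with a negligible error. Thus, by integration term by term,
> `Ĩ₂(ψ) = τ(χψ̄)/(Dp) Σ_m Σ_n κ*(m)a*(n)ψ(m)ψ̄(n)/n · Δ₁(m/(Dpn)) + O(ε)`.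

* `U004.line_eq_termwise` — the §14 twin of the tree's `Section7I1Termwise.I1line_eq_I1termwise`:
  the line integral `(1/2π)∫_ℝ τ((ψχ)‾)(Dp)^{s−1}ϑ*(1−s)(Σ_m κ*(m)ψ(m)m^{−s})(Σ_{n≤2P₄} a*(n)ψ̄(n)n^{s−1})ω(s)dt`
  (`s = 3/2 + it`) EQUALS `τ((ψχ)‾)/(Dp) Σ_m Σ_{n≤2P₄} κ*(m)a*(n)ψ(m)ψ̄(n)n⁻¹Δ₁(m/(Dpn))` exactly
  (Fubini–Tonelli on `σ = 3/2`: `|κ*(m)| ≤ Bτ₅(m)` (14.1) makes the `m`-series absolutely convergent,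
  the `n`-sum is finite, `|(m/(Dpn))^{−s}ϑ*(1−s)| ≤ K(1+|t|)^N (m/(Dpn))^{−3/2}`
  (`Section7I1Kernel.exists_kernel_bound`) against the Gaussian `ω` (`Section7I1Kernel.integrable_majorant`),
  and the exponent bookkeeping `(Dp)^{s−1}n^{s−1}m^{−s} = (m/(Dpn))^{−s}/(Dpn)`
  (`Section7I1Kernel.cpow_bookkeeping`); `Δ₁` of (5.6) is the tree's `Lemma53.Delta1_56 (𝓛₂) (t₀)`);
* `Typed.Sec14.step14u004_holds : Step14u004` — **`Z22:§14.u004` DISCHARGED**, composing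
  `U004.i2Tilde_sub_line_le` (`Section14U004Line`) with `line_eq_termwise`;
* `Typed.Sec14.step14u006a_holds`, `step14u006b_holds`, **`step14u010_holds : Step14u010`** — the
  consequences along the tree's edges `step14u006a_of_u004` (sz-d31, `Section14U006a`),
  `step14u006b_of_u006a` (`TypedSection14Proofs`), `step14u010_of_u006b` (`Section14Regrouping`):
  the input `Step14u010` of `Typed.Sec14.dedProp141_holds` (`DedProp141 : Eq143 → Step14u010 →
  Eq145 → Eq146 → Prop141Zero`) is now a THEOREM; with `eq143_holds` (tree), Proposition 14.1 at
  `β = 0` rests on (14.5) and (14.6) only.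

No new definitions, no new named facts; nothing here asserts Proposition 14.1, Theorems 1–2 or any
statement about Landau–Siegel zeros.

## References

* Y. Zhang, arXiv:2211.02515v1 (2022), §14 p. 76–77, tex L3854–L3896; §7 p. 35, tex L1920–L1924;
  (5.5)–(5.6) p. 26. [cite: Zhang2022LandauSiegel, §14 u004 p.76]
* E. C. Titchmarsh, *The Theory of the Riemann Zeta-Function*, 2nd ed., OUP 1986, §2.15
  (Cahen–Mellin), §4.12 (Stirling). [cite: Titchmarsh1986, §2.15]
-/

noncomputable section

open Complex Real MeasureTheory Filter Topology Set
open scoped ComplexConjugate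

namespace Literature.NumberTheory.LFunctions.Zhang2022.Typed.Sec14.U004

open Skeleton
open Literature.NumberTheory.LFunctions.Zhang2022.Section7I1Kernel

/-! ## §1. The line integral equals the double series -/

/-- **"Integration term by term"** (tex L3858): for `log D > 0` (so `𝓛₂ > 0`), `|κ*| ≤ Bτ₅` and any
`𝐚*`, the line integral of the modified integrand on `σ = 3/2` EQUALS the double series
`τ((ψχ)‾)/(Dp) Σ_m Σ_{n≤2P₄} κ*(m)a*(n)ψ(m)ψ̄(n)n⁻¹Δ₁(m/(Dpn))` (`Δ₁` of (5.6)): Fubini–Tonelli on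
`σ = 3/2` with the exponent bookkeeping `Section7I1Kernel.cpow_bookkeeping`.
[cite: Zhang2022LandauSiegel, §14 u004 p.76, tex L3858] -/
theorem line_eq_termwise {D : ℕ} [NeZero D] (χ : DirichletCharacter ℂ D) (hD : 0 < ell D)
    (x : Chr D) {B : ℝ} {κs : ℕ → ℂ} (hκ : Eq141 B κs) (as : ℕ → ℂ) :
    1 / (2 * π) * ∫ t : ℝ,
        GammaFactor.tau (psiChi χ x)⁻¹ * ((D * x.p : ℕ) : ℂ) ^ (((3 / 2 : ℂ) + t * I) - 1) *
          GammaFactor.varthetaStarOneSub ((3 / 2 : ℂ) + t * I) *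
          (∑' m : ℕ, κs m * x.ψ (m : ZMod x.p) * (m : ℂ) ^ (-((3 / 2 : ℂ) + t * I))) *
          (∑ n ∈ Finset.Icc 1 ⌊2 * P4 D⌋₊, as n * conj (x.ψ (n : ZMod x.p)) *
            (n : ℂ) ^ (((3 / 2 : ℂ) + t * I) - 1)) *
          omegaW D ((3 / 2 : ℂ) + t * I) =
      GammaFactor.tau (psiChi χ x)⁻¹ / ((D : ℂ) * x.p) *
        ∑' m : ℕ, ∑ n ∈ Finset.Icc 1 ⌊2 * P4 D⌋₊,
          κs m * as n * x.ψ (m : ZMod x.p) * conj (x.ψ (n : ZMod x.p)) / (n : ℂ) *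
            Lemma53.Delta1_56 (ell2 D) (t0 D) ((m : ℝ) / ((D : ℝ) * x.p * n)) := by
  classical
  have hL : 0 < ell2 D := by unfold ell2; positivity
  have hp : 0 < x.p := x.prime.pos
  have hD0 : 0 < D := Nat.pos_of_ne_zero (NeZero.ne D)
  have hk0 : 0 < D * x.p := Nat.mul_pos hD0 hp
  have hk' : ((D * x.p : ℕ) : ℂ) ≠ 0 := Nat.cast_ne_zero.mpr hk0.ne'
  have hkR : ((D * x.p : ℕ) : ℝ) = (D : ℝ) * x.p := by push_cast; ring
  have hkC : ((D * x.p : ℕ) : ℂ) = (D : ℂ) * x.p := by push_cast; ring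
  obtain ⟨K, N, hK, hN, hΦ⟩ := exists_kernel_bound
  -- abbreviations (opaque names with defining equations)
  obtain ⟨V, hV⟩ : ∃ V : ℝ → ℂ, V = fun t : ℝ =>
      GammaFactor.varthetaStarOneSub ((3 / 2 : ℂ) + t * I) := ⟨_, rfl⟩
  obtain ⟨W, hW⟩ : ∃ W : ℝ → ℂ, W = fun t : ℝ => omegaW D ((3 / 2 : ℂ) + t * I) := ⟨_, rfl⟩
  obtain ⟨τ, hτ⟩ : ∃ τ : ℂ, τ = GammaFactor.tau (psiChi χ x)⁻¹ := ⟨_, rfl⟩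
  obtain ⟨Nn, hNn⟩ : ∃ Nn : ℕ, Nn = ⌊2 * P4 D⌋₊ := ⟨_, rfl⟩
  -- the summands `H m n t`
  obtain ⟨H, hH⟩ : ∃ H : ℕ → ℕ → ℝ → ℂ, H = fun (m n : ℕ) (t : ℝ) =>
      (κs m * x.ψ (m : ZMod x.p) * (m : ℂ) ^ (-((3 / 2 : ℂ) + t * I))) *
        (as n * conj (x.ψ (n : ZMod x.p)) * (n : ℂ) ^ (((3 / 2 : ℂ) + t * I) - 1)) *
        (τ * ((D * x.p : ℕ) : ℂ) ^ (((3 / 2 : ℂ) + t * I) - 1) * V t * W t) := ⟨_, rfl⟩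
  -- §A. the integrand is `Σ'_m Σ_n H m n t`
  have hintegrand : ∀ t : ℝ,
      τ * ((D * x.p : ℕ) : ℂ) ^ (((3 / 2 : ℂ) + t * I) - 1) *
          GammaFactor.varthetaStarOneSub ((3 / 2 : ℂ) + t * I) *
          (∑' m : ℕ, κs m * x.ψ (m : ZMod x.p) * (m : ℂ) ^ (-((3 / 2 : ℂ) + t * I))) *
          (∑ n ∈ Finset.Icc 1 Nn, as n * conj (x.ψ (n : ZMod x.p)) *
            (n : ℂ) ^ (((3 / 2 : ℂ) + t * I) - 1)) *
          omegaW D ((3 / 2 : ℂ) + t * I) =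
        ∑' m : ℕ, ∑ n ∈ Finset.Icc 1 Nn, H m n t := by
    intro t
    have hVt : GammaFactor.varthetaStarOneSub ((3 / 2 : ℂ) + t * I) = V t := by rw [hV]
    have hWt : omegaW D ((3 / 2 : ℂ) + t * I) = W t := by rw [hW]
    rw [hVt, hWt]
    calc τ * ((D * x.p : ℕ) : ℂ) ^ (((3 / 2 : ℂ) + t * I) - 1) * V t *
          (∑' m : ℕ, κs m * x.ψ (m : ZMod x.p) * (m : ℂ) ^ (-((3 / 2 : ℂ) + t * I))) *
          (∑ n ∈ Finset.Icc 1 Nn, as n * conj (x.ψ (n : ZMod x.p)) *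
            (n : ℂ) ^ (((3 / 2 : ℂ) + t * I) - 1)) * W t
        = (∑' m : ℕ, κs m * x.ψ (m : ZMod x.p) * (m : ℂ) ^ (-((3 / 2 : ℂ) + t * I))) *
            ((∑ n ∈ Finset.Icc 1 Nn, as n * conj (x.ψ (n : ZMod x.p)) *
              (n : ℂ) ^ (((3 / 2 : ℂ) + t * I) - 1)) *
              (τ * ((D * x.p : ℕ) : ℂ) ^ (((3 / 2 : ℂ) + t * I) - 1) * V t * W t)) := by ring
      _ = ∑' m : ℕ, κs m * x.ψ (m : ZMod x.p) * (m : ℂ) ^ (-((3 / 2 : ℂ) + t * I)) *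
            ((∑ n ∈ Finset.Icc 1 Nn, as n * conj (x.ψ (n : ZMod x.p)) *
              (n : ℂ) ^ (((3 / 2 : ℂ) + t * I) - 1)) *
              (τ * ((D * x.p : ℕ) : ℂ) ^ (((3 / 2 : ℂ) + t * I) - 1) * V t * W t)) :=
          tsum_mul_right.symm
      _ = ∑' m : ℕ, ∑ n ∈ Finset.Icc 1 Nn, H m n t := by
          refine tsum_congr fun m => ?_
          rw [Finset.sum_mul, Finset.mul_sum, hH]
          refine Finset.sum_congr rfl fun n _ => ?_
          ring
  -- §B. norms of the factors
  have hmcpow : ∀ (m : ℕ) (s : ℂ), s.re = 3 / 2 → ‖(m : ℂ) ^ (-s)‖ = (m : ℝ) ^ (-(3 / 2 : ℝ)) := by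
    intro m s hs
    rcases Nat.eq_zero_or_pos m with rfl | hm
    · have hs0 : -s ≠ 0 := by
        intro h
        have := congrArg Complex.re h
        simp [hs] at this
      rw [Nat.cast_zero, Complex.zero_cpow hs0, norm_zero, Nat.cast_zero,
        Real.zero_rpow (by norm_num)]
    · rw [Complex.norm_natCast_cpow_of_pos hm, Complex.neg_re, hs]
  have hterm : ∀ m : ℕ, ∀ t : ℝ,
      ‖κs m * x.ψ (m : ZMod x.p) * (m : ℂ) ^ (-((3 / 2 : ℂ) + t * I))‖ =
        ‖κs m * x.ψ (m : ZMod x.p) * (m : ℂ) ^ (-(3 / 2 : ℂ))‖ := by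
    intro m t
    rw [norm_mul, norm_mul (κs m * _), hmcpow m _ (by simp), hmcpow m _ (by simp)]
  have hsub1_ne : ∀ t : ℝ, ((3 / 2 : ℂ) + t * I) - 1 ≠ 0 := by
    intro t h
    have := congrArg Complex.re h
    norm_num at this
  have hncpow : ∀ n : ℕ, ∀ t : ℝ,
      ‖(n : ℂ) ^ (((3 / 2 : ℂ) + t * I) - 1)‖ = (n : ℝ) ^ (1 / 2 : ℝ) := by
    intro n t
    rcases Nat.eq_zero_or_pos n with rfl | hn
    · rw [Nat.cast_zero, Complex.zero_cpow (hsub1_ne t), norm_zero, Nat.cast_zero,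
        Real.zero_rpow (by norm_num)]
    · rw [Complex.norm_natCast_cpow_of_pos hn]
      congr 1
      simp
      norm_num
  have hkcpow : ∀ t : ℝ, ‖((D * x.p : ℕ) : ℂ) ^ (((3 / 2 : ℂ) + t * I) - 1)‖ =
      ((D * x.p : ℕ) : ℝ) ^ (1 / 2 : ℝ) := by
    intro t
    rw [Complex.norm_natCast_cpow_of_pos hk0]
    congr 1
    simp
    norm_num
  have hVle : ∀ t : ℝ, ‖V t‖ ≤ K * (1 + |t|) ^ N := by
    intro t
    have h := hΦ 1 one_pos t
    rw [Complex.ofReal_one, Complex.one_cpow, one_mul, Real.one_rpow, mul_one] at h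
    rw [hV]
    exact h
  obtain ⟨E, hE⟩ : ∃ E : ℝ, E = Real.sqrt π / ell2 D * Real.exp (1 / (4 * ell2 D ^ 2)) := ⟨_, rfl⟩
  have hE0 : 0 ≤ E := by rw [hE]; positivity
  have hWle : ∀ t : ℝ, ‖W t‖ ≤ E * Real.exp (-((t - 2 * π * t0 D) ^ 2) / (4 * ell2 D ^ 2)) := by
    intro t; rw [hW, hE]; exact norm_omega_line_le hL t
  -- the integrable majorant `g`
  obtain ⟨g, hg⟩ : ∃ g : ℝ → ℝ, g = fun t : ℝ =>
      (1 + |t|) ^ N * Real.exp (-((t - 2 * π * t0 D) ^ 2) / (4 * ell2 D ^ 2)) := ⟨_, rfl⟩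
  have hgi : Integrable g := by rw [hg]; exact integrable_majorant hL hN _
  have hg0 : ∀ t, 0 ≤ g t := fun t => by rw [hg]; positivity
  -- per-(m,n) constants
  obtain ⟨cst, hcst⟩ : ∃ cst : ℕ → ℕ → ℝ, cst = fun (m n : ℕ) =>
      ‖κs m * x.ψ (m : ZMod x.p) * (m : ℂ) ^ (-(3 / 2 : ℂ))‖ *
        (‖as n‖ * ‖conj (x.ψ (n : ZMod x.p))‖ * (n : ℝ) ^ (1 / 2 : ℝ)) *
        (‖τ‖ * ((D * x.p : ℕ) : ℝ) ^ (1 / 2 : ℝ) * K * E) := ⟨_, rfl⟩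
  have hcst' : ∀ m n, cst m n = ‖κs m * x.ψ (m : ZMod x.p) * (m : ℂ) ^ (-(3 / 2 : ℂ))‖ *
      (‖as n‖ * ‖conj (x.ψ (n : ZMod x.p))‖ * (n : ℝ) ^ (1 / 2 : ℝ)) *
      (‖τ‖ * ((D * x.p : ℕ) : ℝ) ^ (1 / 2 : ℝ) * K * E) := fun m n => by rw [hcst]
  have hg' : ∀ t, g t = (1 + |t|) ^ N * Real.exp (-((t - 2 * π * t0 D) ^ 2) / (4 * ell2 D ^ 2)) :=
    fun t => by rw [hg]
  have hcst0 : ∀ m n, 0 ≤ cst m n := fun m n => by rw [hcst']; positivity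
  have hHle : ∀ m n t, ‖H m n t‖ ≤ cst m n * g t := by
    intro m n t
    have h1 := hVle t
    have h2 := hWle t
    have hW0 : 0 ≤ ‖W t‖ := norm_nonneg _
    have hA0 : 0 ≤ ‖κs m * x.ψ (m : ZMod x.p) * (m : ℂ) ^ (-(3 / 2 : ℂ))‖ *
        (‖as n‖ * ‖conj (x.ψ (n : ZMod x.p))‖ * (n : ℝ) ^ (1 / 2 : ℝ)) *
        (‖τ‖ * ((D * x.p : ℕ) : ℝ) ^ (1 / 2 : ℝ)) := by positivity
    have e1 : ‖H m n t‖ = ‖κs m * x.ψ (m : ZMod x.p) * (m : ℂ) ^ (-(3 / 2 : ℂ))‖ *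
        (‖as n‖ * ‖conj (x.ψ (n : ZMod x.p))‖ * (n : ℝ) ^ (1 / 2 : ℝ)) *
        (‖τ‖ * ((D * x.p : ℕ) : ℝ) ^ (1 / 2 : ℝ)) * (‖V t‖ * ‖W t‖) := by
      rw [hH]
      beta_reduce
      rw [norm_mul, norm_mul, hterm m t]
      simp only [norm_mul]
      rw [hncpow n t, hkcpow t]
      ring
    rw [e1, hcst', hg']
    calc ‖κs m * x.ψ (m : ZMod x.p) * (m : ℂ) ^ (-(3 / 2 : ℂ))‖ *
          (‖as n‖ * ‖conj (x.ψ (n : ZMod x.p))‖ * (n : ℝ) ^ (1 / 2 : ℝ)) *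
          (‖τ‖ * ((D * x.p : ℕ) : ℝ) ^ (1 / 2 : ℝ)) * (‖V t‖ * ‖W t‖)
        ≤ ‖κs m * x.ψ (m : ZMod x.p) * (m : ℂ) ^ (-(3 / 2 : ℂ))‖ *
            (‖as n‖ * ‖conj (x.ψ (n : ZMod x.p))‖ * (n : ℝ) ^ (1 / 2 : ℝ)) *
            (‖τ‖ * ((D * x.p : ℕ) : ℝ) ^ (1 / 2 : ℝ)) *
            ((K * (1 + |t|) ^ N) * (E * Real.exp (-((t - 2 * π * t0 D) ^ 2) / (4 * ell2 D ^ 2)))) :=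
          mul_le_mul_of_nonneg_left (mul_le_mul h1 h2 hW0 (by positivity)) hA0
      _ = _ := by ring
  -- continuity and integrability of each `H m n`
  have hVc : Continuous V := by rw [hV]; exact continuous_varthetaStar
  have hWc : Continuous W := by rw [hW]; exact continuous_omega_line D
  have hHint : ∀ m n, Integrable (H m n) := by
    intro m n
    refine (hgi.const_mul (cst m n)).mono' ?_ (Eventually.of_forall (hHle m n))
    rcases Nat.eq_zero_or_pos m with rfl | hm
    · have : H 0 n = fun _ => 0 := by
        funext t; rw [hH]; simp only [Nat.cast_zero, MulChar.map_zero, mul_zero, zero_mul]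
      rw [this]; exact aestronglyMeasurable_const
    rcases Nat.eq_zero_or_pos n with rfl | hn
    · have : H m 0 = fun _ => 0 := by
        funext t
        rw [hH]
        simp only [Nat.cast_zero, MulChar.map_zero, map_zero, mul_zero, zero_mul]
      rw [this]; exact aestronglyMeasurable_const
    -- `m, n ≥ 1`: continuous
    have hmc : Continuous fun t : ℝ => (m : ℂ) ^ (-((3 / 2 : ℂ) + t * I)) :=
      continuous_iff_continuousAt.2 fun t =>
        (continuousAt_const_cpow (Nat.cast_ne_zero.mpr hm.ne')).comp
          (by fun_prop : Continuous fun t : ℝ => -((3 / 2 : ℂ) + t * I)).continuousAt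
    have hnc : Continuous fun t : ℝ => (n : ℂ) ^ (((3 / 2 : ℂ) + t * I) - 1) :=
      continuous_iff_continuousAt.2 fun t =>
        (continuousAt_const_cpow (Nat.cast_ne_zero.mpr hn.ne')).comp
          (by fun_prop : Continuous fun t : ℝ => ((3 / 2 : ℂ) + t * I) - 1).continuousAt
    have hkc : Continuous fun t : ℝ => ((D * x.p : ℕ) : ℂ) ^ (((3 / 2 : ℂ) + t * I) - 1) :=
      continuous_iff_continuousAt.2 fun t =>
        (continuousAt_const_cpow hk').comp
          (by fun_prop : Continuous fun t : ℝ => ((3 / 2 : ℂ) + t * I) - 1).continuousAt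
    have hc : Continuous (H m n) := by
      rw [hH]
      exact ((continuous_const.mul hmc).mul (continuous_const.mul hnc)).mul
        (((continuous_const.mul hkc).mul hVc).mul hWc)
    exact hc.aestronglyMeasurable
  -- summability in `m` of `∫ ‖Σ_n H m n‖`
  have hsum_b : Summable fun m : ℕ => ‖κs m * x.ψ (m : ZMod x.p) * (m : ℂ) ^ (-(3 / 2 : ℂ))‖ :=
    (Eq143.summable_twist x hκ (s := (3 / 2 : ℂ)) (by norm_num)).norm
  obtain ⟨G, hG⟩ : ∃ G : ℝ, G = ∫ t, g t := ⟨_, rfl⟩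
  have hG0 : 0 ≤ G := by rw [hG]; exact integral_nonneg hg0
  obtain ⟨Cn, hCn⟩ : ∃ Cn : ℝ, Cn = ∑ n ∈ Finset.Icc 1 Nn,
      (‖as n‖ * ‖conj (x.ψ (n : ZMod x.p))‖ * (n : ℝ) ^ (1 / 2 : ℝ)) *
        (‖τ‖ * ((D * x.p : ℕ) : ℝ) ^ (1 / 2 : ℝ) * K * E) := ⟨_, rfl⟩
  have hCn0 : 0 ≤ Cn := by rw [hCn]; exact Finset.sum_nonneg fun n _ => by positivity
  have hnorm_int : ∀ m, ∫ t, ‖∑ n ∈ Finset.Icc 1 Nn, H m n t‖ ≤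
      ‖κs m * x.ψ (m : ZMod x.p) * (m : ℂ) ^ (-(3 / 2 : ℂ))‖ * Cn * G := by
    intro m
    have hmaj : Integrable fun t =>
        (‖κs m * x.ψ (m : ZMod x.p) * (m : ℂ) ^ (-(3 / 2 : ℂ))‖ * Cn) * g t := hgi.const_mul _
    calc ∫ t, ‖∑ n ∈ Finset.Icc 1 Nn, H m n t‖
        ≤ ∫ t, (‖κs m * x.ψ (m : ZMod x.p) * (m : ℂ) ^ (-(3 / 2 : ℂ))‖ * Cn) * g t := by
          refine integral_mono_of_nonneg (Eventually.of_forall fun t => norm_nonneg _) hmaj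
            (Eventually.of_forall fun t => ?_)
          calc ‖∑ n ∈ Finset.Icc 1 Nn, H m n t‖ ≤ ∑ n ∈ Finset.Icc 1 Nn, ‖H m n t‖ :=
                norm_sum_le _ _
            _ ≤ ∑ n ∈ Finset.Icc 1 Nn, cst m n * g t := Finset.sum_le_sum fun n _ => hHle m n t
            _ = (‖κs m * x.ψ (m : ZMod x.p) * (m : ℂ) ^ (-(3 / 2 : ℂ))‖ * Cn) * g t := by
                rw [hCn, Finset.mul_sum, Finset.sum_mul]
                refine Finset.sum_congr rfl fun n _ => ?_
                rw [hcst']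
                ring
      _ = ‖κs m * x.ψ (m : ZMod x.p) * (m : ℂ) ^ (-(3 / 2 : ℂ))‖ * Cn * G := by
          rw [integral_const_mul, hG]
  have hsumm : Summable fun m => ∫ t, ‖∑ n ∈ Finset.Icc 1 Nn, H m n t‖ := by
    refine Summable.of_nonneg_of_le (fun m => integral_nonneg fun t => norm_nonneg _) hnorm_int ?_
    exact (hsum_b.mul_right Cn).mul_right G
  have hFint : ∀ m, Integrable fun t => ∑ n ∈ Finset.Icc 1 Nn, H m n t :=
    fun m => integrable_finsetSum _ fun n _ => hHint m n
  -- §C. Fubini: `∫ Σ'_m Σ_n = Σ'_m Σ_n ∫`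
  have hFubini : ∫ t, ∑' m : ℕ, ∑ n ∈ Finset.Icc 1 Nn, H m n t =
      ∑' m : ℕ, ∑ n ∈ Finset.Icc 1 Nn, ∫ t, H m n t := by
    rw [← integral_tsum_of_summable_integral_norm hFint hsumm]
    refine tsum_congr fun m => ?_
    exact integral_finsetSum _ fun n _ => hHint m n
  -- §D. the individual integrals
  have hΔ : ∀ m n : ℕ, 0 < m → 0 < n →
      1 / (2 * π) * ∫ t, H m n t =
        τ / ((D : ℂ) * x.p) *
          (κs m * as n * x.ψ (m : ZMod x.p) * conj (x.ψ (n : ZMod x.p)) / (n : ℂ) *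
            Lemma53.Delta1_56 (ell2 D) (t0 D) ((m : ℝ) / ((D : ℝ) * x.p * n))) := by
    intro m n hm hn
    have hy : (0 : ℝ) < (m : ℝ) / ((D : ℝ) * x.p * n) := by positivity
    have hpt : ∀ t : ℝ, H m n t =
        (τ / ((D : ℂ) * x.p) * (κs m * as n * x.ψ (m : ZMod x.p) *
          conj (x.ψ (n : ZMod x.p)) / (n : ℂ))) *
          (((((m : ℝ) / ((D : ℝ) * x.p * n)) : ℝ) : ℂ) ^ (-((3 / 2 : ℂ) + t * I)) * V t * W t) := by
      intro t
      have key := cpow_bookkeeping hk0 hm hn ((3 / 2 : ℂ) + t * I)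
      rw [neg_sub, div_eq_mul_inv, ← Complex.cpow_neg, hkR] at key
      rw [hH]
      calc κs m * x.ψ (m : ZMod x.p) * (m : ℂ) ^ (-((3 / 2 : ℂ) + t * I)) *
            (as n * conj (x.ψ (n : ZMod x.p)) * (n : ℂ) ^ (((3 / 2 : ℂ) + t * I) - 1)) *
            (τ * ((D * x.p : ℕ) : ℂ) ^ (((3 / 2 : ℂ) + t * I) - 1) * V t * W t)
          = (κs m * x.ψ (m : ZMod x.p) * as n * conj (x.ψ (n : ZMod x.p)) * τ * V t * W t) *
              (((D * x.p : ℕ) : ℂ) ^ (((3 / 2 : ℂ) + t * I) - 1) *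
                (n : ℂ) ^ (((3 / 2 : ℂ) + t * I) - 1) * (m : ℂ) ^ (-((3 / 2 : ℂ) + t * I))) := by
            ring
        _ = (κs m * x.ψ (m : ZMod x.p) * as n * conj (x.ψ (n : ZMod x.p)) * τ * V t * W t) *
              (((((m : ℝ) / ((D : ℝ) * x.p * n)) : ℝ) : ℂ) ^ (-((3 / 2 : ℂ) + t * I)) /
                (((D * x.p : ℕ) : ℂ) * n)) := by rw [key]
        _ = _ := by rw [hkC]; ring
    have hΔ1 : Lemma53.Delta1_56 (ell2 D) (t0 D) ((m : ℝ) / ((D : ℝ) * x.p * n)) = 1 / (2 * π) *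
        ∫ t : ℝ, ((((m : ℝ) / ((D : ℝ) * x.p * n)) : ℝ) : ℂ) ^ (-((3 / 2 : ℂ) + t * I)) *
          V t * W t := by
      rw [hV, hW]; rfl
    simp_rw [hpt]
    rw [integral_const_mul, hΔ1]
    ring
  have hH0m : ∀ n : ℕ, ∀ t : ℝ, H 0 n t = 0 := by
    intro n t; rw [hH]; simp only [Nat.cast_zero, MulChar.map_zero, mul_zero, zero_mul]
  -- §E. assemble
  have hlhs : 1 / (2 * π) * ∫ t : ℝ,
      GammaFactor.tau (psiChi χ x)⁻¹ * ((D * x.p : ℕ) : ℂ) ^ (((3 / 2 : ℂ) + t * I) - 1) *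
        GammaFactor.varthetaStarOneSub ((3 / 2 : ℂ) + t * I) *
        (∑' m : ℕ, κs m * x.ψ (m : ZMod x.p) * (m : ℂ) ^ (-((3 / 2 : ℂ) + t * I))) *
        (∑ n ∈ Finset.Icc 1 ⌊2 * P4 D⌋₊, as n * conj (x.ψ (n : ZMod x.p)) *
          (n : ℂ) ^ (((3 / 2 : ℂ) + t * I) - 1)) *
        omegaW D ((3 / 2 : ℂ) + t * I) =
      1 / (2 * π) * ∫ t : ℝ, ∑' m : ℕ, ∑ n ∈ Finset.Icc 1 Nn, H m n t := by
    rw [← hτ, ← hNn]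
    congr 1
    refine integral_congr_ae (Eventually.of_forall fun t => ?_)
    exact hintegrand t
  rw [hlhs, hFubini, ← hτ, ← hNn, ← tsum_mul_left, ← tsum_mul_left]
  refine tsum_congr fun m => ?_
  rw [Finset.mul_sum, Finset.mul_sum]
  rcases Nat.eq_zero_or_pos m with rfl | hm
  · -- `m = 0`: both sides vanish termwise (`ψ(0) = 0`)
    have h1 : ∀ n ∈ Finset.Icc 1 Nn, 1 / (2 * (π : ℂ)) * ∫ t : ℝ, H 0 n t = 0 := by
      intro n _; simp_rw [hH0m]; simp
    have h2 : ∀ n ∈ Finset.Icc 1 Nn, τ / ((D : ℂ) * x.p) *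
        (κs 0 * as n * x.ψ ((0 : ℕ) : ZMod x.p) * conj (x.ψ (n : ZMod x.p)) / (n : ℂ) *
          Lemma53.Delta1_56 (ell2 D) (t0 D) (((0 : ℕ) : ℝ) / ((D : ℝ) * x.p * n))) = 0 := by
      intro n _
      simp only [Nat.cast_zero, MulChar.map_zero, mul_zero, zero_mul, zero_div]
    rw [Finset.sum_eq_zero h1, Finset.sum_eq_zero h2]
  · -- `m ≥ 1`: the terms are `hΔ`
    refine Finset.sum_congr rfl fun n hn => ?_
    have hn1 : 0 < n := (Finset.mem_Icc.mp hn).1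
    rw [hΔ m n hm hn1]

end Literature.NumberTheory.LFunctions.Zhang2022.Typed.Sec14.U004

/-! ## §2. The nodes `Z22:§14.u004`, `u006`, `u010` -/

namespace Literature.NumberTheory.LFunctions.Zhang2022.Typed.Sec14

open Skeleton

/-- **`Z22:§14.u004` DISCHARGED** (§14 p. 76, tex L3858): `Typed.Sec14.Step14u004` HOLDS — for every
`B` there are `c > 0`, `C` (those of `U004.i2Tilde_sub_line_le`: `c = 1/16`) such that for all large `D`,
all real primitive `χ (mod D)`, all `ψ ∈ Ψ` and all `𝐤*, 𝐚*` with (14.1)–(14.2),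
`Ĩ₂(ψ) = τ(χψ̄)/(Dp) Σ_mΣ_n κ*(m)a*(n)ψ(m)ψ̄(n)n⁻¹Δ₁(m/(Dpn)) + O(e^{−c𝓛¹⁰})`: the segment `𝔍(1)`
replaced by the line `σ = 3/2` (`U004.i2Tilde_sub_line_le`) and the line integral integrated term by
term (`U004.line_eq_termwise`). The Assumption (A) binder is not used.
[cite: Zhang2022LandauSiegel, §14 u004 p.76, tex L3858] -/
theorem step14u004_holds : Step14u004 := by
  intro B
  obtain ⟨c, hc, C, D₀, hD₀⟩ := U004.i2Tilde_sub_line_le B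
  refine ⟨c, hc, C, max D₀ 2, fun D _ χ hD hq hp _ x κs as hκ ha => ?_⟩
  have hD2 : 2 ≤ D := le_trans (le_max_right _ _) hD
  have hℓ : 0 < ell D := by
    unfold ell
    exact Real.log_pos (by exact_mod_cast (by omega : 1 < D))
  rw [← U004.line_eq_termwise χ hℓ x hκ as]
  exact hD₀ D χ (le_trans (le_max_left _ _) hD) hq hp x κs as hκ ha

/-- **`Z22:§14.u006` (first line) HOLDS** — along the tree's edge `step14u006a_of_u004` (sz-d31,
`Section14U006a`: summing u004 over the primitive `ψ (mod p)` with u005 and `|τ(χψ⁰_p)| = √D`).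
[cite: Zhang2022LandauSiegel, §14 u006 p.77, tex L3862–L3866] -/
theorem step14u006a_holds : Step14u006a := step14u006a_of_u004 step14u004_holds

/-- **`Z22:§14.u006` (second line) HOLDS** — along the tree's edge `step14u006b_of_u006a`
(`TypedSection14Proofs`: the substitution `d = (m,n)`, `m = dl`, `n = dk`).
[cite: Zhang2022LandauSiegel, §14 u006 p.77, tex L3866–L3871] -/
theorem step14u006b_holds : Step14u006b := step14u006b_of_u006a step14u006a_holds

/-- **`Z22:§14.u010` DISCHARGED** (§14 p. 77, tex L3896): `Typed.Sec14.Step14u010` HOLDS —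
`Σ*_{ψ (mod p)} Ĩ₂(ψ) = τ(χ)χ(p)/D Σ_{D=D₁D₂} 𝒮(D₁,D₂;p) + O(PT^{−c})`, along the tree's edge
`step14u010_of_u006b` (`Section14Regrouping`: (14.4) via u007/u008, then u009). This is the second
input of `Typed.Sec14.dedProp141_holds` (`DedProp141 : Eq143 → Step14u010 → Eq145 → Eq146 →
Prop141Zero`); with `eq143_holds` the `β = 0` case of Proposition 14.1 now rests on (14.5), (14.6).
[cite: Zhang2022LandauSiegel, §14 u010 p.77, tex L3896] -/
theorem step14u010_holds : Step14u010 := step14u010_of_u006b step14u006b_holds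

/-- **Proposition 14.1 at `β = 0` from (14.5) and (14.6) alone**: with (14.3) (`eq143_holds`) and
u010 (`step14u010_holds`) theorems (`Eq143.eq143_holds`), the tree's proof node `dedProp141_holds` leaves `Prop141Zero` on
exactly the two estimates the manuscript reduces it to ("the proof of Proposition 14.1 is now reduced to
showing (14.5) and (14.6)", p. 78). [cite: Zhang2022LandauSiegel, §14 Prop. 14.1 (proof) p.78, tex L3905–L3917] -/
theorem prop141Zero_of_eq145_eq146 (h145 : Eq145) (h146 : Eq146) : Prop141Zero :=
  dedProp141_holds Eq143.eq143_holds step14u010_holds h145 h146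

end Literature.NumberTheory.LFunctions.Zhang2022.Typed.Sec14
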